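import Summits.CriticalPhenomena.Ising3DConformalLimit.Theorems.PrecisionLaplacianEtaBoundsTransferFourier
import Summits.CriticalPhenomena.Ising3DConformalLimit.Theorems.PrecisionLaplacianEtaBoundsTransferGreen

/-!
# Pick inversion, auxiliary file 9: real convolution powers and the Green series of a
# sub-stochastic step law (maximum principle without strict positivity)

Helper file for stub `stub_pickInversion` of line `self-energy-pick-inversion`, crux
`PrecisionLaplacian.DirectCorrelationStableTail` (stmt-CriticalPhenomena-4799). Pure theorem file.

For a nonnegative summable step law `q` on `ℤ^d` with `∑ q ≤ 1` and its real convolution powers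
`P 0 = δ₀`, `P (j+1) = q ∗ P j` (entering through defining hypotheses):

* `convPow_nonneg_summable` : `P j ≥ 0`, `P j ∈ ℓ¹`, `∑ P j ≤ 1`;
* `sum_range_convPow_le` : if `G = δ₀ + q ∗ G` with `G ≥ 0` bounded then `∑_{j<J} P j ≤ G`;
* `hasSum_convPow_of_green_equation` (registered sub-goal `stub_pickInversion_auxGreenSeries`): if
  moreover `G → 0` at infinity then `∑_j P j z = G z` for every `z` — the deficit `G - ∑ P j` is a
  nonnegative `q`-harmonic function vanishing at infinity, hence `0` by the maximum principle. Unlike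
  the tree's `EtaBoundsTransfer.green_repr` we do NOT assume `q > 0` off the origin: at a maximum
  point `x₀` of the deficit, `u(x₀ - y₀) = u(x₀)` for one `y₀` with `q y₀ > 0`, and iterating along
  `x₀ - n y₀` produces infinitely many maxima, contradicting decay (if `q ≡ 0` the deficit is `0`).
-/

noncomputable section

namespace Summit.CriticalPhenomena.Ising3DConformalLimit.Cruxes.DirectCorrelationStableTail.SelfEnergyPickInversion

open Filter Topology Finset Literature.Probability.LatticeModels
open scoped BigOperators
open Summit.CriticalPhenomena.Ising3DConformalLimit.Theorems.EtaBoundsTransfer (summable_shear tsum_sub_right)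

variable {d : ℕ} {q : Site d → ℝ} {P : ℕ → Site d → ℝ}

/-! ### Nonnegativity, summability and mass of the convolution powers -/

/-- **Real convolution powers of a sub-probability**: `P j ≥ 0`, `P j` is summable and
`∑_z P j z ≤ 1`. [folklore] -/
theorem convPow_nonneg_summable (hq0 : ∀ y, 0 ≤ q y) (hqs : Summable q) (hq1 : ∑' y, q y ≤ 1)
    (hP0 : ∀ z, P 0 z = if z = 0 then 1 else 0)
    (hPs : ∀ j z, P (j + 1) z = ∑' y, q y * P j (z - y)) (j : ℕ) :
    (∀ z, 0 ≤ P j z) ∧ Summable (P j) ∧ ∑' z, P j z ≤ 1 := by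
  induction j with
  | zero =>
    refine ⟨fun z => by rw [hP0]; split_ifs <;> norm_num, ?_, ?_⟩
    · apply summable_of_ne_finset_zero (s := {0})
      intro z hz; rw [Finset.mem_singleton] at hz; rw [hP0, if_neg hz]
    · rw [tsum_eq_single 0 (fun z hz => by rw [hP0, if_neg hz]), hP0, if_pos rfl]
  | succ j ih =>
    obtain ⟨hnn, hsum, hle⟩ := ih
    have hF : Summable fun p : Site d × Site d => q p.1 * P j (p.2 - p.1) := summable_shear hqs hsum hq0 hnn
    have hF' : Summable fun p : Site d × Site d => q p.2 * P j (p.1 - p.2) :=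
      (Equiv.prodComm (Site d) (Site d)).summable_iff.2 hF |>.congr fun p => by simp [Equiv.prodComm]
    have hnn' : ∀ z, 0 ≤ P (j + 1) z := fun z => by
      rw [hPs]; exact tsum_nonneg fun y => mul_nonneg (hq0 y) (hnn _)
    have hsum' : Summable (P (j + 1)) := by
      have h := hF'.prod
      refine h.congr fun z => ?_
      simp only [hPs]
    refine ⟨hnn', hsum', ?_⟩
    calc ∑' z, P (j + 1) z = ∑' z, ∑' y, q y * P j (z - y) := tsum_congr fun z => hPs j z
      _ = ∑' p : Site d × Site d, q p.2 * P j (p.1 - p.2) := (hF'.tsum_prod).symm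
      _ = ∑' p : Site d × Site d, q p.1 * P j (p.2 - p.1) :=
          (Equiv.prodComm (Site d) (Site d)).tsum_eq (fun p : Site d × Site d => q p.1 * P j (p.2 - p.1))
      _ = ∑' y, ∑' z, q y * P j (z - y) := hF.tsum_prod
      _ = ∑' y, q y * ∑' z, P j z := by
          refine tsum_congr fun y => ?_
          rw [tsum_mul_left, tsum_sub_right (P j) y]
      _ = (∑' y, q y) * ∑' z, P j z := tsum_mul_right
      _ ≤ 1 * 1 := mul_le_mul hq1 hle (tsum_nonneg hnn) zero_le_one
      _ = 1 := one_mul _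

/-! ### Partial Green sums are dominated by a solution of the equation -/

/-- Summability of `y ↦ q(y) F(z - y)` for bounded `F ≥ 0`. [folklore] -/
theorem summable_q_mul_of_bounded (hq0 : ∀ y, 0 ≤ q y) (hqs : Summable q) {F : Site d → ℝ} {C : ℝ}
    (hF0 : ∀ z, 0 ≤ F z) (hFC : ∀ z, F z ≤ C) (z : Site d) : Summable fun y => q y * F (z - y) :=
  Summable.of_nonneg_of_le (fun y => mul_nonneg (hq0 y) (hF0 _))
    (fun y => mul_le_mul_of_nonneg_left (hFC _) (hq0 y)) (hqs.mul_right C)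

/-- **Partial Green sums**: if `G = δ₀ + q ∗ G` with `G ≥ 0` bounded, then `∑_{j<J} P j z ≤ G z`.
[folklore] -/
theorem sum_range_convPow_le (hq0 : ∀ y, 0 ≤ q y) (hqs : Summable q) (hq1 : ∑' y, q y ≤ 1)
    (hP0 : ∀ z, P 0 z = if z = 0 then 1 else 0)
    (hPs : ∀ j z, P (j + 1) z = ∑' y, q y * P j (z - y))
    {G : Site d → ℝ} {C : ℝ} (hG0 : ∀ z, 0 ≤ G z) (hGC : ∀ z, G z ≤ C)
    (hGeq : ∀ z, G z = (if z = 0 then 1 else 0) + ∑' y, q y * G (z - y)) (J : ℕ) (z : Site d) :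
    ∑ j ∈ Finset.range J, P j z ≤ G z := by
  induction J generalizing z with
  | zero => simp [hG0 z]
  | succ J ih =>
    rw [Finset.sum_range_succ', hP0, hGeq z, add_comm]
    gcongr
    -- `∑_{j<J} P (j+1) z = ∑' y, q y * ∑_{j<J} P j (z - y) ≤ ∑' y, q y * G (z - y)`
    have hPs' : ∀ j, (fun z => P (j + 1) z) = fun z => ∑' y, q y * P j (z - y) := fun j => funext (hPs j)
    have hsj : ∀ j, Summable fun y => q y * P j (z - y) := by
      intro j
      obtain ⟨hnn, hsum, hle⟩ := convPow_nonneg_summable hq0 hqs hq1 hP0 hPs j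
      exact summable_q_mul_of_bounded hq0 hqs hnn (fun w => (hsum.le_tsum w fun _ _ => hnn _).trans hle) z
    calc ∑ j ∈ Finset.range J, P (j + 1) z = ∑ j ∈ Finset.range J, ∑' y, q y * P j (z - y) :=
          Finset.sum_congr rfl fun j _ => hPs j z
      _ = ∑' y, ∑ j ∈ Finset.range J, q y * P j (z - y) := (Summable.tsum_finsetSum fun j _ => hsj j).symm
      _ = ∑' y, q y * ∑ j ∈ Finset.range J, P j (z - y) := by simp_rw [Finset.mul_sum]
      _ ≤ ∑' y, q y * G (z - y) := by
          refine Summable.tsum_le_tsum (fun y => mul_le_mul_of_nonneg_left (ih _) (hq0 y)) ?_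
            (summable_q_mul_of_bounded hq0 hqs hG0 hGC z)
          have : (fun y => q y * ∑ j ∈ Finset.range J, P j (z - y)) = fun y => ∑ j ∈ Finset.range J, q y * P j (z - y) := by
            funext y; rw [Finset.mul_sum]
          rw [this]
          exact summable_sum fun j _ => hsj j

/-! ### The maximum principle (weak positivity) and the Green series -/

/-- Multiples `n • y₀` of a nonzero lattice vector are pairwise distinct. [folklore] -/
theorem natSmul_injective_of_ne_zero {y₀ : Site d} (hy₀ : y₀ ≠ 0) :
    Function.Injective fun n : ℕ => (n : ℤ) • y₀ := by
  obtain ⟨i, hi⟩ : ∃ i, y₀ i ≠ 0 := by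
    by_contra h; push Not at h; exact hy₀ (funext h)
  intro n m hnm
  have := congr_fun hnm i
  simp only [Pi.smul_apply, smul_eq_mul] at this
  exact_mod_cast mul_right_cancel₀ hi this

/-- **Maximum principle, weak positivity.** A nonnegative `q`-harmonic function on `ℤ^d` tending to
`0` at infinity vanishes, for a nonnegative summable `q` with `∑ q ≤ 1` (no strict positivity
needed: if `q ≡ 0` the function is `0`; otherwise maxima propagate along `-y₀` for one `y₀` with
`q y₀ > 0`). [folklore] -/
theorem harmonic_eq_zero_weak {h : Site d → ℝ} (hq0 : ∀ y, 0 ≤ q y) (hqs : Summable q)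
    (hq1 : ∑' y, q y ≤ 1) (hq00 : q 0 = 0) (hh0 : ∀ z, 0 ≤ h z) (hhto : Tendsto h cofinite (𝓝 0))
    (hsum : ∀ z, Summable fun y => q y * h (z - y))
    (hharm : ∀ z, h z = ∑' y, q y * h (z - y)) : ∀ z, h z = 0 := by
  by_cases hqz : ∀ y, q y = 0
  · intro z; rw [hharm z]; simp [hqz]
  push Not at hqz
  obtain ⟨y₀, hy₀⟩ := hqz
  have hy₀pos : 0 < q y₀ := lt_of_le_of_ne (hq0 y₀) (Ne.symm hy₀)
  have hy₀ne : y₀ ≠ 0 := fun h0 => hy₀ (h0 ▸ hq00)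
  by_contra hne
  push Not at hne
  obtain ⟨x₁, hx₁⟩ := hne
  have hx₁pos : 0 < h x₁ := lt_of_le_of_ne (hh0 x₁) (Ne.symm hx₁)
  -- a maximum point `x₀`
  have hfin : {z | h x₁ ≤ h z}.Finite := by
    have hev : ∀ᶠ z in cofinite, h z < h x₁ := hhto.eventually (gt_mem_nhds hx₁pos)
    simpa [not_lt] using Filter.eventually_cofinite.1 hev
  have hx₁F : x₁ ∈ hfin.toFinset := hfin.mem_toFinset.2 (show h x₁ ≤ h x₁ from le_rfl)
  obtain ⟨x₀, hx₀F, hmax⟩ := Finset.exists_max_image hfin.toFinset h ⟨x₁, hx₁F⟩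
  have hx₀ge : h x₁ ≤ h x₀ := hfin.mem_toFinset.1 hx₀F
  have hle : ∀ z, h z ≤ h x₀ := fun z => by
    by_cases hz : h x₁ ≤ h z
    · exact hmax z (hfin.mem_toFinset.2 hz)
    · exact (le_of_lt (not_le.1 hz)).trans hx₀ge
  -- maxima propagate along `-y₀`
  have hprop : ∀ x, h x = h x₀ → h (x - y₀) = h x₀ := by
    intro x hx
    have hdiff_summ : Summable (fun y => q y * (h x₀ - h (x - y))) := by
      have : (fun y => q y * (h x₀ - h (x - y))) = fun y => q y * h x₀ - q y * h (x - y) := by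
        funext y; ring
      rw [this]; exact (hqs.mul_right _).sub (hsum x)
    have hdiff_nn : ∀ y, 0 ≤ q y * (h x₀ - h (x - y)) :=
      fun y => mul_nonneg (hq0 y) (by linarith [hle (x - y)])
    have hdiff_le : ∑' y, q y * (h x₀ - h (x - y)) ≤ 0 := by
      have h1 : ∑' y, q y * (h x₀ - h (x - y)) = (∑' y, q y) * h x₀ - h x := by
        rw [show (fun y => q y * (h x₀ - h (x - y))) = fun y => q y * h x₀ - q y * h (x - y) from
          funext fun y => by ring, (hqs.mul_right _).tsum_sub (hsum x), tsum_mul_right, ← hharm x]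
      rw [h1, hx]
      nlinarith [hh0 x₀]
    have hzero : q y₀ * (h x₀ - h (x - y₀)) = 0 := by
      have h0 : ∑' y, q y * (h x₀ - h (x - y)) = 0 := le_antisymm hdiff_le (tsum_nonneg hdiff_nn)
      have := hdiff_summ.hasSum
      rw [h0] at this
      exact congr_fun ((hasSum_zero_iff_of_nonneg hdiff_nn).1 this) y₀
    rcases mul_eq_zero.1 hzero with h1 | h1
    · exact absurd h1 hy₀pos.ne'
    · linarith
  have hiter : ∀ n : ℕ, h (x₀ - (n : ℤ) • y₀) = h x₀ := by
    intro n
    induction n with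
    | zero => simp
    | succ n ih =>
      have := hprop _ ih
      rw [show x₀ - (n : ℤ) • y₀ - y₀ = x₀ - ((n + 1 : ℕ) : ℤ) • y₀ by push_cast; rw [add_smul, one_smul]; abel] at this
      exact this
  -- infinitely many maxima contradict decay
  have hinf : Set.Infinite {z | h x₁ ≤ h z} := by
    have hinj : Function.Injective fun n : ℕ => x₀ - (n : ℤ) • y₀ :=
      fun n m hnm => natSmul_injective_of_ne_zero hy₀ne (sub_right_injective hnm)
    refine Set.infinite_of_injective_forall_mem hinj fun n => ?_
    show h x₁ ≤ h (x₀ - (n : ℤ) • y₀)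
    rw [hiter n]; exact hx₀ge
  exact hinf hfin

/-- **The Green series of a sub-stochastic step law.** Let `q ≥ 0` be summable with `∑ q ≤ 1`,
`q 0 = 0`, with real convolution powers `P`, and let `G ≥ 0` be bounded, tend to `0` at infinity and
solve `G = δ₀ + q ∗ G`. Then `∑_j P j z = G z` for every `z`. [folklore] -/
theorem hasSum_convPow_of_green_equation (hq0 : ∀ y, 0 ≤ q y) (hqs : Summable q)
    (hq1 : ∑' y, q y ≤ 1) (hq00 : q 0 = 0)
    (hP0 : ∀ z, P 0 z = if z = 0 then 1 else 0)
    (hPs : ∀ j z, P (j + 1) z = ∑' y, q y * P j (z - y))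
    {G : Site d → ℝ} {C : ℝ} (hG0 : ∀ z, 0 ≤ G z) (hGC : ∀ z, G z ≤ C)
    (hGto : Tendsto G cofinite (𝓝 0))
    (hGeq : ∀ z, G z = (if z = 0 then 1 else 0) + ∑' y, q y * G (z - y)) (z : Site d) :
    HasSum (fun j => P j z) (G z) := by
  have hPfacts := convPow_nonneg_summable hq0 hqs hq1 hP0 hPs
  have hPnn : ∀ j z, 0 ≤ P j z := fun j => (hPfacts j).1
  have hpart := sum_range_convPow_le hq0 hqs hq1 hP0 hPs hG0 hGC hGeq
  -- summability in `j` and the limit `L z ≤ G z`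
  have hSz : ∀ z, Summable fun j => P j z := fun z =>
    summable_of_sum_range_le (fun j => hPnn j z) (fun J => hpart J z)
  set L : Site d → ℝ := fun z => ∑' j, P j z with hL
  have hLle : ∀ z, L z ≤ G z := fun z =>
    Real.tsum_le_of_sum_range_le (fun j => hPnn j z) (fun J => hpart J z)
  have hL0 : ∀ z, 0 ≤ L z := fun z => tsum_nonneg fun j => hPnn j z
  have hsumG := summable_q_mul_of_bounded hq0 hqs hG0 hGC
  have hsumL : ∀ z, Summable fun y => q y * L (z - y) := fun z =>
    Summable.of_nonneg_of_le (fun y => mul_nonneg (hq0 y) (hL0 _))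
      (fun y => mul_le_mul_of_nonneg_left (hLle _) (hq0 y)) (hsumG z)
  -- `L = δ₀ + q ∗ L`
  have hLeq : ∀ z, L z = (if z = 0 then 1 else 0) + ∑' y, q y * L (z - y) := by
    intro z
    have hfam_nn : 0 ≤ fun p : Site d × ℕ => q p.1 * P p.2 (z - p.1) :=
      fun p => mul_nonneg (hq0 _) (hPnn _ _)
    have hfam : Summable fun p : Site d × ℕ => q p.1 * P p.2 (z - p.1) := by
      rw [summable_prod_of_nonneg hfam_nn]
      refine ⟨fun y => (hSz (z - y)).mul_left (q y), ?_⟩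
      have : (fun y => ∑' j, q y * P j (z - y)) = fun y => q y * L (z - y) := by
        funext y; rw [tsum_mul_left]
      simp only [this]
      exact hsumL z
    calc L z = P 0 z + ∑' j, P (j + 1) z := (hSz z).tsum_eq_zero_add
      _ = (if z = 0 then 1 else 0) + ∑' j, ∑' y, q y * P j (z - y) := by
          rw [hP0]; congr 1; exact tsum_congr fun j => hPs j z
      _ = (if z = 0 then 1 else 0) + ∑' y, ∑' j, q y * P j (z - y) := by
          rw [Summable.tsum_comm (f := fun y j => q y * P j (z - y)) (by exact hfam)]
      _ = (if z = 0 then 1 else 0) + ∑' y, q y * L (z - y) := by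
          congr 1; refine tsum_congr fun y => ?_; rw [tsum_mul_left]
  -- the deficit `u = G - L` is `q`-harmonic, nonnegative and tends to `0`
  set u : Site d → ℝ := fun z => G z - L z with hu
  have hu0 : ∀ z, 0 ≤ u z := fun z => by simp only [hu]; linarith [hLle z]
  have huto : Tendsto u cofinite (𝓝 0) := by
    apply tendsto_of_tendsto_of_tendsto_of_le_of_le tendsto_const_nhds hGto
    · exact hu0
    · intro z; simp only [hu]; linarith [hL0 z]
  have hsumu : ∀ z, Summable fun y => q y * u (z - y) := by
    intro z
    have : (fun y => q y * u (z - y)) = fun y => q y * G (z - y) - q y * L (z - y) := by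
      funext y; simp only [hu]; ring
    rw [this]; exact (hsumG z).sub (hsumL z)
  have hharm : ∀ z, u z = ∑' y, q y * u (z - y) := by
    intro z
    have : (fun y => q y * u (z - y)) = fun y => q y * G (z - y) - q y * L (z - y) := by
      funext y; simp only [hu]; ring
    rw [this, (hsumG z).tsum_sub (hsumL z)]
    simp only [hu]
    have e1 := hGeq z
    have e2 := hLeq z
    linarith
  have hzero := harmonic_eq_zero_weak hq0 hqs hq1 hq00 hu0 huto hsumu hharm z
  have hGL : G z = L z := by simp only [hu] at hzero; linarith
  rw [hGL]
  exact (hSz z).hasSum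

/-- **Registered auxiliary stub `stub_pickInversion_auxGreenSeries`** (sub-goal of
`stub_pickInversion`): the Green series of a sub-stochastic step law on `ℤ³`
(`hasSum_convPow_of_green_equation`). [folklore] -/
theorem stub_pickInversion_auxGreenSeries : ∀ (q : Site 3 → ℝ) (P : ℕ → Site 3 → ℝ) (G : Site 3 → ℝ) (C : ℝ),
    (∀ y, 0 ≤ q y) → Summable q → ∑' y, q y ≤ 1 → q 0 = 0 →
    (∀ z, P 0 z = if z = 0 then 1 else 0) → (∀ j z, P (j + 1) z = ∑' y, q y * P j (z - y)) →
    (∀ z, 0 ≤ G z) → (∀ z, G z ≤ C) → Filter.Tendsto G Filter.cofinite (nhds 0) →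
    (∀ z, G z = (if z = 0 then 1 else 0) + ∑' y, q y * G (z - y)) →
    ∀ z, HasSum (fun j => P j z) (G z) :=
  fun _ _ _ _ hq0 hqs hq1 hq00 hP0 hPs hG0 hGC hGto hGeq z =>
    hasSum_convPow_of_green_equation hq0 hqs hq1 hq00 hP0 hPs hG0 hGC hGto hGeq z

end Summit.CriticalPhenomena.Ising3DConformalLimit.Cruxes.DirectCorrelationStableTail.SelfEnergyPickInversion

end
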